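import Literature.Computability.MetaComplexity.AndProductSpanLowerBound

/-!
# Sparse product-function uncertainty on the Boolean cube, and isolation in product-function relations

Setting of `AndProductSpanLowerBound` (Barrington–Straubing–Thérien 1990, §6): over a field `F`, for
`w ∈ Fⁿ` the PRODUCT FUNCTION `Q_w : {0,1}ⁿ → F`, `Q_w(u) = ∏_{i : u_i = 1} w_i` (`ProductSpan.prodFn`).
BST90 Theorem 7 (tree: `ProductSpan.pow_le_card_mul_pow_of_and_eq_sum_prodFn`) says that `AND_n` — a
function with ONE non-zero — is not a combination of fewer than `(k/(k−1))ⁿ` product functions with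
entries from a `k`-set `S ∌ 0`.  This file supplies the two quantitative forms of the same
restrict-and-subtract induction that a sparse analysis needs:

* **SPUL** (sparse product-function uncertainty lemma, `two_pow_le_two_pow_mul_suppCard`,
  unindexed form `two_pow_le_two_pow_mul_suppCard'`): if `g = Σ_{j ∈ J} a_j Q_{w_j}` on `{0,1}ⁿ`,
  all `w_j ∈ Sⁿ`, `0 ∉ S`, `|S| ≤ k`, `g ≢ 0` and `|J|·(k−1)^A ≤ k^A`, then `2ⁿ ≤ 2^A·|supp g|`
  (DENSITY form of Theorem 7: a non-zero `s`-sparse combination is non-zero on a `≥ 2^{−A}`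
  fraction of the cube, `A = ⌈log_{k/(k−1)} s⌉`; for `S = 𝔽₄ˣ`, `k = 3`: density
  `≥ 2^{−⌈log_{3/2} s⌉}`).  `0 ∉ S` is necessary (`Q_{0ⁿ} = [u = 0]`).  For `k = 2` this is the
  uncertainty principle `|supp f|·|supp f̂| ≥ |G|` on `G = ℤ₂ⁿ`; for `k ≥ 3` the cube is not a group
  and the exponent is genuinely different.
* **The restriction functional** `evalFn n λ` (`E_λ`, iterate `f ↦ f|_{u_i=1} − λ_i·f|_{u_i=0}`):
  linear, `E_λ(Q_w) = ∏_i (w_i − λ_i)` (`evalFn_prodFn`) — so a relation `Σ_j a_j Q_{w_j} ≡ 0` on the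
  cube gives `Σ_j a_j ∏_i (w_{ji} − λ_i) = 0` for EVERY `λ ∈ Fⁿ`.
* **Isolation lemma** (`card_pow_le_sum_prod_card_erase`): in such a relation, if the constant
  character `w_{j₁} = 𝟙` has `a_{j₁} ≠ 0` and `T ⊆ F ∖ {1}` is finite, the boxes `∏_i (T ∖ {w_{ji}})`,
  `j ≠ j₁`, cover `Tⁿ`, whence `|T|ⁿ ≤ Σ_{j ≠ j₁} ∏_i |T ∖ {w_{ji}}|`; with `|T| = 2` and every other
  member having `≥ d` entries in `T`: `2^d + 1 ≤ |J|` (`two_pow_add_one_le_card`).  After dividing a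
  relation by `Q_w`: a member with non-zero coefficient has another member within Hamming distance
  `log₂(|J| − 1)`.  Tight (`𝔽₄`): `1 + ω Q_{ω e_i} + ω² Q_{ω² e_i} ≡ 0`.
* **Parity-class isolation** (characteristic `2`, `ω² + ω + 1 = 0`, entries in `{1, ω, ω²}`;
  `parity_isolation`, `parity_isolation_dist`, core form `parity_isolation_core`): for a relation
  holding only on a parity class `H_p = {u : #ones(u) ≡ p (2)}`, a pattern with non-zero NET
  coefficient at Hamming distance `≥ d` from all other patterns forces
  `2^{n−1} ≤ 3·n·#{other patterns}·2^{n−d}`.  Tool: `1_{H_p}·Q_w = (1+p+n)Q_w − Σ_i Q_{w[i↦0]}`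
  (`hpProd_eq`), so `E_λ(1_{H_p} Q_w)` dies after two coincidences `λ_i = w_i`.

Status of the statements: the density and isolation forms are not located in print (searched:
BST90, Barrington–Straubing 1994, Smolensky 1987/1993, Nisan–Szegedy 1994, Grolmusz 1995/2001,
Jukna 2012 §12); they are consequences of the printed method, supplied here with proofs — the
degree analogue (`≥ 2^{n−d}` non-zeros for degree `d`) and the hyperplane-covering form are
Alon–Füredi 1993.  Everything here is PROVED; no named facts.  Consumer: cell qa-qnc0 (ROUND-32,
fibre dichotomy for the mod-3 ring game, `--supports stmt-QuantumAdvantage-22907`).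

## References

* D. A. Mix Barrington, H. Straubing, D. Thérien, *Non-uniform automata over groups*, Inform. and
  Comput. 89 (1990) 109–132, §6 Theorem 7 and Proposition (pp. 123–125). [BarringtonStraubingTherien1990]
* N. Alon, Z. Füredi, *Covering the cube by affine hyperplanes*, European J. Combin. 14 (1993)
  79–83, Theorem 1 and its counting corollary. [AlonFuredi1993]
-/

namespace Literature.Computability.MetaComplexity

namespace ProductSpan

open Finset

section SPUL

variable {F : Type*} [Field F] [DecidableEq F]

/-- The number of points of `{0,1}ⁿ` at which `f` does not vanish (`|supp f|`). [folklore] -/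
def suppCard {n : ℕ} (f : (Fin n → Bool) → F) : ℕ := (univ.filter fun u => f u ≠ 0).card

/-- A function with a non-zero value has positive support size. [cite: BarringtonStraubingTherien1990, §6 (setting: functions on the cube and product functions, p. 124); elementary] -/
theorem suppCard_pos_of_exists {n : ℕ} {f : (Fin n → Bool) → F} (h : ∃ u, f u ≠ 0) :
    0 < suppCard f := by
  obtain ⟨u, hu⟩ := h
  exact Finset.card_pos.2 ⟨u, Finset.mem_filter.2 ⟨Finset.mem_univ _, hu⟩⟩

/-- `|supp f| ≤ 2ⁿ`. [cite: BarringtonStraubingTherien1990, §6 (setting: functions on the cube and product functions, p. 124); elementary] -/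
theorem suppCard_le {n : ℕ} (f : (Fin n → Bool) → F) : suppCard f ≤ 2 ^ n := by
  unfold suppCard
  calc (univ.filter fun u => f u ≠ 0).card ≤ (univ : Finset (Fin n → Bool)).card :=
        Finset.card_filter_le _ _
    _ = 2 ^ n := by simp

/-- Splitting the support along the first coordinate. [cite: BarringtonStraubingTherien1990, §6 (setting: functions on the cube and product functions, p. 124); elementary] -/
theorem suppCard_succ {n : ℕ} (f : (Fin (n + 1) → Bool) → F) :
    suppCard f = suppCard (fun u' => f (Fin.cons true u')) +
      suppCard (fun u' => f (Fin.cons false u')) := by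
  unfold suppCard
  simp only [Finset.card_filter]
  rw [← Equiv.sum_comp (Fin.consEquiv fun _ : Fin (n + 1) => Bool), Fintype.sum_prod_type,
    Fintype.sum_bool]
  rfl

omit [DecidableEq F] in
/-- A product function with admissible (hence non-zero) entries never vanishes.
[cite: BarringtonStraubingTherien1990, §6 (p. 124)] -/
theorem prodFn_ne_zero {n : ℕ} {S : Finset F} (hS0 : (0 : F) ∉ S) {w : Fin n → F}
    (hw : ∀ i, w i ∈ S) (u : Fin n → Bool) : prodFn w u ≠ 0 := by
  unfold prodFn
  refine Finset.prod_ne_zero_iff.2 fun i _ => ?_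
  split_ifs
  · exact fun h => hS0 (h ▸ hw i)
  · exact one_ne_zero

/-- **SPUL** (sparse product-function uncertainty lemma), indexed form.
If `g = Σ_{j ∈ J} a_j Q_{w_j}` on `{0,1}ⁿ` with entries in `S ∌ 0`, `|S| ≤ k`,
`|J|·(k-1)^A ≤ k^A`, and `g ≢ 0`, then `2ⁿ ≤ 2^A · |supp g|`.  (BST90 Theorem 7 is the case
`g = AND_n`, `|supp g| = 1`: `pow_le_card_mul_pow_of_and_eq_sum_prodFn`.)
[cite: BarringtonStraubingTherien1990, §6 Thm. 7 and Proposition (pp. 123–125) — density form supplied here, same restriction induction] -/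
theorem two_pow_le_two_pow_mul_suppCard (S : Finset F) (hS0 : (0 : F) ∉ S) {k : ℕ}
    (hk : S.card ≤ k) {ι : Type*} :
    ∀ (n A : ℕ) (J : Finset ι) (a : ι → F) (w : ι → Fin n → F) (g : (Fin n → Bool) → F),
      (∀ j ∈ J, ∀ i, w j i ∈ S) → J.card * (k - 1) ^ A ≤ k ^ A →
      (∀ u, g u = ∑ j ∈ J, a j * prodFn (w j) u) → (∃ u, g u ≠ 0) →
      2 ^ n ≤ 2 ^ A * suppCard g := by
  intro n
  induction n with
  | zero =>
    intro A J a w g _ _ _ h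
    have hpos := suppCard_pos_of_exists h
    calc 2 ^ 0 = 1 := rfl
      _ ≤ 2 ^ A := Nat.one_le_two_pow
      _ = 2 ^ A * 1 := (mul_one _).symm
      _ ≤ 2 ^ A * suppCard g := Nat.mul_le_mul_left _ hpos
  | succ n ih =>
    intro A J a w g hJS hA hrep h
    -- the two restrictions along the first coordinate
    obtain ⟨g1, hg1⟩ : ∃ g1 : (Fin n → Bool) → F, ∀ u', g1 u' = g (Fin.cons true u') :=
      ⟨_, fun _ => rfl⟩
    obtain ⟨g0, hg0⟩ : ∃ g0 : (Fin n → Bool) → F, ∀ u', g0 u' = g (Fin.cons false u') :=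
      ⟨_, fun _ => rfl⟩
    have hg1rep : ∀ u', g1 u' = ∑ j ∈ J, a j * w j 0 * prodFn (Fin.tail (w j)) u' := by
      intro u'
      rw [hg1, hrep]
      refine Finset.sum_congr rfl fun j _ => ?_
      rw [prodFn_cons_true]; ring
    have hg0rep : ∀ u', g0 u' = ∑ j ∈ J, a j * prodFn (Fin.tail (w j)) u' := by
      intro u'
      rw [hg0, hrep]
      refine Finset.sum_congr rfl fun j _ => ?_
      rw [prodFn_cons_false]
    have hsplit : suppCard g = suppCard g1 + suppCard g0 := by
      have e1 : (fun u' => g (Fin.cons true u')) = g1 := funext fun u' => (hg1 u').symm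
      have e0 : (fun u' => g (Fin.cons false u')) = g0 := funext fun u' => (hg0 u').symm
      rw [suppCard_succ, e1, e0]
    -- `J` is non-empty, so `S` is non-empty and `1 ≤ k`
    have hJne : J.Nonempty := by
      by_contra hJ
      rw [Finset.not_nonempty_iff_eq_empty] at hJ
      obtain ⟨u, hu⟩ := h
      exact hu (by rw [hrep u, hJ, Finset.sum_empty])
    have hSne : S.Nonempty := by
      obtain ⟨j, hj⟩ := hJne
      exact ⟨w j 0, hJS j hj 0⟩
    have hk1 : 1 ≤ k := Nat.lt_of_lt_of_le (Finset.card_pos.2 hSne) hk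
    have htailS : ∀ J₁ : Finset ι, J₁ ⊆ J → ∀ j ∈ J₁, ∀ i, Fin.tail (w j) i ∈ S :=
      fun J₁ hJ₁ j hj i => hJS j (hJ₁ hj) i.succ
    -- the most popular first entry `λ`
    set mult : F → ℕ := fun b => (J.filter fun j => w j 0 = b).card with hmult
    have hsum : ∑ b ∈ S, mult b = J.card := by
      rw [hmult, ← Finset.card_eq_sum_card_fiberwise fun j hj => hJS j hj 0]
    obtain ⟨lam, hlamS, hlam⟩ := Finset.exists_max_image S mult hSne
    have hlam0 : lam ≠ 0 := fun e => hS0 (e ▸ hlamS)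
    have hpigeon : J.card ≤ k * mult lam := by
      rw [← hsum]
      calc ∑ b ∈ S, mult b ≤ ∑ _b ∈ S, mult lam := Finset.sum_le_sum fun b hb => hlam b hb
        _ = S.card * mult lam := by rw [Finset.sum_const, smul_eq_mul]
        _ ≤ k * mult lam := Nat.mul_le_mul_right _ hk
    set Jl : Finset ι := J.filter fun j => w j 0 ≠ lam with hJl
    have hcardJl : Jl.card + mult lam = J.card := by
      rw [hJl, hmult]
      have hc := Finset.card_filter_add_card_filter_not (s := J) (fun j => w j 0 ≠ lam)
      have e : (J.filter fun j => ¬ w j 0 ≠ lam) = J.filter fun j => w j 0 = lam :=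
        Finset.filter_congr fun j _ => not_not
      rw [e] at hc
      exact hc
    have hkey : k * Jl.card ≤ (k - 1) * J.card := by
      have e1 : k * Jl.card + k * mult lam = k * J.card := by rw [← mul_add, hcardJl]
      have e2 : (k - 1) * J.card + J.card = k * J.card := by
        rw [Nat.sub_mul, Nat.one_mul, Nat.sub_add_cancel (Nat.le_mul_of_pos_left _ hk1)]
      omega
    -- if one restriction vanishes identically then `A ≥ 1`
    have hA1 : ((∀ u', g1 u' = 0) ∨ (∀ u', g0 u' = 0)) → ∃ A', A = A' + 1 := by
      intro hor
      cases A with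
      | succ A' => exact ⟨A', rfl⟩
      | zero =>
        exfalso
        rw [pow_zero, pow_zero, mul_one] at hA
        obtain ⟨j₀, hj₀⟩ := hJne
        have hJ1 : J = {j₀} :=
          Finset.eq_singleton_iff_unique_mem.2 ⟨hj₀, fun j hj => Finset.card_le_one.1 hA j hj j₀ hj₀⟩
        obtain ⟨u, hu⟩ := h
        rw [hrep u, hJ1, Finset.sum_singleton] at hu
        have hc : a j₀ ≠ 0 := fun hc => hu (by rw [hc, zero_mul])
        have hwS : ∀ i, w j₀ i ∈ S := hJS j₀ hj₀
        have htS : ∀ i, Fin.tail (w j₀) i ∈ S := fun i => hwS i.succ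
        have h00 : w j₀ 0 ≠ 0 := fun e => hS0 (e ▸ hwS 0)
        rcases hor with hz | hz
        · have hz' := hz (fun _ => false)
          rw [hg1rep, hJ1, Finset.sum_singleton] at hz'
          exact (mul_ne_zero (mul_ne_zero hc h00) (prodFn_ne_zero hS0 htS _)) hz'
        · have hz' := hz (fun _ => false)
          rw [hg0rep, hJ1, Finset.sum_singleton] at hz'
          exact (mul_ne_zero hc (prodFn_ne_zero hS0 htS _)) hz'
    -- the kill step: a representation `gg = Σ_j a_j d(w_j 0) Q_{w_j'}` with `d λ = 0` uses only
    -- the `≤ (k-1)/k · |J|` indices of `Jl`, so the induction hypothesis applies with `A - 1`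
    have hstep : ∀ A' : ℕ, A = A' + 1 → ∀ d : F → F, d lam = 0 →
        ∀ gg : (Fin n → Bool) → F,
        (∀ u', gg u' = ∑ j ∈ J, a j * d (w j 0) * prodFn (Fin.tail (w j)) u') →
        (∃ u', gg u' ≠ 0) → 2 ^ n ≤ 2 ^ A' * suppCard gg := by
      intro A' hAA' d hd gg hgg hne
      have hrep' : ∀ u', gg u' = ∑ j ∈ Jl, (a j * d (w j 0)) * prodFn (Fin.tail (w j)) u' := by
        intro u'
        rw [hgg u', hJl, Finset.sum_filter]
        refine Finset.sum_congr rfl fun j _ => ?_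
        by_cases hj0 : w j 0 = lam
        · rw [if_neg (not_not.2 hj0), hj0, hd, mul_zero, zero_mul]
        · rw [if_pos hj0]
      have hcard' : Jl.card * (k - 1) ^ A' ≤ k ^ A' := by
        refine Nat.le_of_mul_le_mul_left ?_ (Nat.lt_of_lt_of_le Nat.zero_lt_one hk1)
        calc k * (Jl.card * (k - 1) ^ A') = k * Jl.card * (k - 1) ^ A' := by ring
          _ ≤ (k - 1) * J.card * (k - 1) ^ A' := Nat.mul_le_mul_right _ hkey
          _ = J.card * (k - 1) ^ (A' + 1) := by ring
          _ ≤ k ^ (A' + 1) := hAA' ▸ hA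
          _ = k * k ^ A' := by ring
      exact ih A' Jl (fun j => a j * d (w j 0)) (fun j => Fin.tail (w j)) gg
        (htailS Jl (Finset.filter_subset _ _)) hcard' hrep' hne
    by_cases h1 : ∃ u', g1 u' ≠ 0
    · by_cases h0 : ∃ u', g0 u' ≠ 0
      · -- (a) both restrictions are non-zero: same `A`, same index set
        have hIH1 := ih A J (fun j => a j * w j 0) (fun j => Fin.tail (w j)) g1
          (htailS J (Finset.Subset.refl _)) hA hg1rep h1
        have hIH0 := ih A J a (fun j => Fin.tail (w j)) g0
          (htailS J (Finset.Subset.refl _)) hA hg0rep h0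
        rw [hsplit]
        calc 2 ^ (n + 1) = 2 ^ n + 2 ^ n := by ring
          _ ≤ 2 ^ A * suppCard g1 + 2 ^ A * suppCard g0 := Nat.add_le_add hIH1 hIH0
          _ = 2 ^ A * (suppCard g1 + suppCard g0) := by ring
      · -- (c) `g0 ≡ 0`: `g1 = g1 - λ·g0 = Σ_j a_j (w_j 0 - λ) Q_{w_j'}`
        push Not at h0
        obtain ⟨A', hAA'⟩ := hA1 (Or.inr h0)
        have hgg : ∀ u', g1 u' = ∑ j ∈ J, a j * (fun b => b - lam) (w j 0) *
            prodFn (Fin.tail (w j)) u' := by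
          intro u'
          beta_reduce
          have h3 : ∑ j ∈ J, a j * (w j 0 - lam) * prodFn (Fin.tail (w j)) u' =
              g1 u' - lam * g0 u' := by
            rw [hg1rep, hg0rep, Finset.mul_sum, ← Finset.sum_sub_distrib]
            refine Finset.sum_congr rfl fun j _ => ?_
            ring
          rw [h3, h0 u', mul_zero, sub_zero]
        have hIH := hstep A' hAA' (fun b => b - lam) (sub_self lam) g1 hgg h1
        rw [hsplit, hAA']
        calc 2 ^ (n + 1) = 2 ^ n * 2 := pow_succ 2 n
          _ ≤ 2 ^ A' * suppCard g1 * 2 := Nat.mul_le_mul_right _ hIH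
          _ = 2 ^ (A' + 1) * suppCard g1 := by ring
          _ ≤ 2 ^ (A' + 1) * (suppCard g1 + suppCard g0) :=
              Nat.mul_le_mul_left _ (Nat.le_add_right _ _)
    · -- (b) `g1 ≡ 0`: then `g0 ≢ 0` and `g0 = g0 - λ⁻¹·g1 = Σ_j a_j (1 - λ⁻¹ w_j 0) Q_{w_j'}`
      push Not at h1
      have h0 : ∃ u', g0 u' ≠ 0 := by
        obtain ⟨u, hu⟩ := h
        have hu' : g (Fin.cons (u 0) (Fin.tail u)) ≠ 0 := by rwa [Fin.cons_self_tail]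
        refine ⟨Fin.tail u, ?_⟩
        rw [hg0]
        cases hb : u 0 with
        | false => rwa [hb] at hu'
        | true =>
          rw [hb, ← hg1] at hu'
          exact absurd (h1 _) hu'
      obtain ⟨A', hAA'⟩ := hA1 (Or.inl h1)
      have hgg : ∀ u', g0 u' = ∑ j ∈ J, a j * (fun b => 1 - lam⁻¹ * b) (w j 0) *
          prodFn (Fin.tail (w j)) u' := by
        intro u'
        beta_reduce
        have h3 : ∑ j ∈ J, a j * (1 - lam⁻¹ * w j 0) * prodFn (Fin.tail (w j)) u' =
            g0 u' - lam⁻¹ * g1 u' := by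
          rw [hg1rep, hg0rep, Finset.mul_sum, ← Finset.sum_sub_distrib]
          refine Finset.sum_congr rfl fun j _ => ?_
          ring
        rw [h3, h1 u', mul_zero, sub_zero]
      have hd : (fun b => 1 - lam⁻¹ * b) lam = 0 := by
        beta_reduce
        rw [inv_mul_cancel₀ hlam0, sub_self]
      have hIH := hstep A' hAA' (fun b => 1 - lam⁻¹ * b) hd g0 hgg h0
      rw [hsplit, hAA']
      calc 2 ^ (n + 1) = 2 ^ n * 2 := pow_succ 2 n
        _ ≤ 2 ^ A' * suppCard g0 * 2 := Nat.mul_le_mul_right _ hIH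
        _ = 2 ^ (A' + 1) * suppCard g0 := by ring
        _ ≤ 2 ^ (A' + 1) * (suppCard g1 + suppCard g0) :=
            Nat.mul_le_mul_left _ (Nat.le_add_left _ _)

/-- **SPUL**, unindexed form (`J = 𝒲 ⊆ Sⁿ`, coefficients `c : (Fin n → F) → F`).
[cite: BarringtonStraubingTherien1990, §6 Thm. 7 and Proposition (pp. 123–125) — density form supplied here] -/
theorem two_pow_le_two_pow_mul_suppCard' (S : Finset F) (hS0 : (0 : F) ∉ S) {k : ℕ}
    (hk : S.card ≤ k) {n : ℕ} (A : ℕ) (W : Finset (Fin n → F)) (c : (Fin n → F) → F)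
    (hW : ∀ w ∈ W, ∀ i, w i ∈ S) (hA : W.card * (k - 1) ^ A ≤ k ^ A)
    (h : ∃ u, ∑ w ∈ W, c w * prodFn w u ≠ 0) :
    2 ^ n ≤ 2 ^ A * suppCard (fun u => ∑ w ∈ W, c w * prodFn w u) :=
  two_pow_le_two_pow_mul_suppCard S hS0 hk n A W c id _ hW hA (fun _ => rfl) h

end SPUL

section Isolation

variable {F : Type*} [Field F]

/-- The restriction functional `E_λ`: `E_λ(f) = E_{λ'}(f(1,·)) − λ₀ · E_{λ'}(f(0,·))` — the
restrict-and-subtract step of BST90's proof of Theorem 7, iterated over all coordinates with a free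
parameter `λ ∈ Fⁿ`; `E_λ(f) = Σ_u f(u) ∏_{i : u_i = 0} (−λ_i)`.
[cite: BarringtonStraubingTherien1990, §6 Thm. 7 and Proposition (pp. 123–125) (proof) — functional form supplied here] -/
def evalFn : (n : ℕ) → (Fin n → F) → ((Fin n → Bool) → F) → F
  | 0, _, f => f (fun i => i.elim0)
  | n + 1, lam, f => evalFn n (Fin.tail lam) (fun u' => f (Fin.cons true u')) -
      lam 0 * evalFn n (Fin.tail lam) (fun u' => f (Fin.cons false u'))

/-- `E_λ(0) = 0`. [cite: BarringtonStraubingTherien1990, §6 Thm. 7 (proof: the restriction step); elementary] -/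
theorem evalFn_zero : ∀ (n : ℕ) (lam : Fin n → F), evalFn n lam (fun _ => 0) = 0 := by
  intro n
  induction n with
  | zero => intro lam; rfl
  | succ n ih =>
    intro lam
    show evalFn n (Fin.tail lam) (fun _ => 0) - lam 0 * evalFn n (Fin.tail lam) (fun _ => 0) = 0
    rw [ih]; ring

/-- `E_λ(c·f) = c·E_λ(f)`. [cite: BarringtonStraubingTherien1990, §6 Thm. 7 (proof: the restriction step); elementary] -/
theorem evalFn_const_mul : ∀ (n : ℕ) (lam : Fin n → F) (c : F) (f g : (Fin n → Bool) → F),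
    (∀ u, g u = c * f u) → evalFn n lam g = c * evalFn n lam f := by
  intro n
  induction n with
  | zero => intro lam c f g hg; exact hg _
  | succ n ih =>
    intro lam c f g hg
    have h1 := ih (Fin.tail lam) c (fun u' => f (Fin.cons true u'))
      (fun u' => g (Fin.cons true u')) (fun u' => hg _)
    have h0 := ih (Fin.tail lam) c (fun u' => f (Fin.cons false u'))
      (fun u' => g (Fin.cons false u')) (fun u' => hg _)
    show evalFn n (Fin.tail lam) (fun u' => g (Fin.cons true u')) -
        lam 0 * evalFn n (Fin.tail lam) (fun u' => g (Fin.cons false u')) =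
      c * (evalFn n (Fin.tail lam) (fun u' => f (Fin.cons true u')) -
        lam 0 * evalFn n (Fin.tail lam) (fun u' => f (Fin.cons false u')))
    rw [h1, h0]; ring

/-- Linearity of `E_λ` on finite combinations. [cite: BarringtonStraubingTherien1990, §6 Thm. 7 (proof: the restriction step); elementary] -/
theorem evalFn_sum {ι : Type*} (J : Finset ι) (a : ι → F) :
    ∀ (n : ℕ) (lam : Fin n → F) (f : ι → (Fin n → Bool) → F) (g : (Fin n → Bool) → F),
      (∀ u, g u = ∑ j ∈ J, a j * f j u) →
      evalFn n lam g = ∑ j ∈ J, a j * evalFn n lam (f j) := by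
  intro n
  induction n with
  | zero => intro lam f g hg; exact hg _
  | succ n ih =>
    intro lam f g hg
    have h1 := ih (Fin.tail lam) (fun j u' => f j (Fin.cons true u'))
      (fun u' => g (Fin.cons true u')) (fun u' => hg _)
    have h0 := ih (Fin.tail lam) (fun j u' => f j (Fin.cons false u'))
      (fun u' => g (Fin.cons false u')) (fun u' => hg _)
    beta_reduce at h1 h0
    show evalFn n (Fin.tail lam) (fun u' => g (Fin.cons true u')) -
        lam 0 * evalFn n (Fin.tail lam) (fun u' => g (Fin.cons false u')) = _
    rw [h1, h0, Finset.mul_sum, ← Finset.sum_sub_distrib]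
    refine Finset.sum_congr rfl fun j _ => ?_
    show _ = a j * (evalFn n (Fin.tail lam) (fun u' => f j (Fin.cons true u')) -
        lam 0 * evalFn n (Fin.tail lam) (fun u' => f j (Fin.cons false u')))
    ring

/-- `E_λ(Q_w) = ∏_i (w_i − λ_i)`. [cite: BarringtonStraubingTherien1990, §6 Thm. 7 and Proposition (pp. 123–125) (proof: one restriction step) — iterated form supplied here] -/
theorem evalFn_prodFn : ∀ (n : ℕ) (lam w : Fin n → F),
    evalFn n lam (prodFn w) = ∏ i, (w i - lam i) := by
  intro n
  induction n with
  | zero =>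
    intro lam w
    show prodFn w _ = _
    rw [prodFn_zero, Fin.prod_univ_zero]
  | succ n ih =>
    intro lam w
    have e1 : evalFn n (Fin.tail lam) (fun u' => prodFn w (Fin.cons true u')) =
        w 0 * evalFn n (Fin.tail lam) (prodFn (Fin.tail w)) :=
      evalFn_const_mul n (Fin.tail lam) (w 0) (prodFn (Fin.tail w)) _
        (fun u' => prodFn_cons_true w u')
    have e0 : (fun u' => prodFn w (Fin.cons false u')) = prodFn (Fin.tail w) :=
      funext (prodFn_cons_false w)
    show evalFn n (Fin.tail lam) (fun u' => prodFn w (Fin.cons true u')) -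
        lam 0 * evalFn n (Fin.tail lam) (fun u' => prodFn w (Fin.cons false u')) = _
    rw [e1, e0, ih, Fin.prod_univ_succ]
    simp only [Fin.tail]
    ring

variable [DecidableEq F]

/-- **Isolation lemma** (general `T`): in a product-function relation on `{0,1}ⁿ` the constant
character `𝟙` with non-zero coefficient forces `|T|ⁿ ≤ Σ_{j ≠ j₁} ∏_i |T ∖ {w_{j i}}|`
(the boxes `∏_i (T ∖ {w_{j i}})`, `j ≠ j₁`, cover `Tⁿ`).
[cite: BarringtonStraubingTherien1990, §6 Thm. 7 and Proposition (pp. 123–125) — isolation form supplied here; cf. AlonFuredi1993, Thm. 1 (covering the cube minus a vertex)] -/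
theorem card_pow_le_sum_prod_card_erase {n : ℕ} {ι : Type*} [DecidableEq ι] (T : Finset F)
    (h1T : (1 : F) ∉ T) (J : Finset ι) (a : ι → F) (w : ι → Fin n → F) (j₁ : ι) (hj₁ : j₁ ∈ J)
    (hw₁ : ∀ i, w j₁ i = 1) (ha₁ : a j₁ ≠ 0)
    (hrel : ∀ u, ∑ j ∈ J, a j * prodFn (w j) u = 0) :
    T.card ^ n ≤ ∑ j ∈ J.erase j₁, ∏ i, (T.erase (w j i)).card := by
  set Λ : Finset (Fin n → F) := Fintype.piFinset fun _ => T with hΛ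
  have hΛcard : Λ.card = T.card ^ n := by rw [hΛ, Fintype.card_piFinset_const]
  -- every `λ ∈ Tⁿ` is served by some `j ≠ j₁` with `λ_i ≠ w_{j i}` for all `i`
  have hcover : ∀ lam ∈ Λ, ∃ j ∈ J.erase j₁,
      lam ∈ Fintype.piFinset fun i => T.erase (w j i) := by
    intro lam hlam
    have hlamT : ∀ i, lam i ∈ T := Fintype.mem_piFinset.1 hlam
    -- `E_λ` applied to the relation
    have hE : ∑ j ∈ J, a j * ∏ i, (w j i - lam i) = 0 := by
      have h := evalFn_sum J a n lam (fun j => prodFn (w j)) (fun _ => 0)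
        (fun u => (hrel u).symm)
      rw [evalFn_zero] at h
      calc ∑ j ∈ J, a j * ∏ i, (w j i - lam i)
          = ∑ j ∈ J, a j * evalFn n lam (prodFn (w j)) :=
            Finset.sum_congr rfl fun j _ => by rw [evalFn_prodFn]
        _ = 0 := h.symm
    have h1 : a j₁ * ∏ i, (w j₁ i - lam i) ≠ 0 := by
      refine mul_ne_zero ha₁ (Finset.prod_ne_zero_iff.2 fun i _ => ?_)
      rw [hw₁ i]
      exact sub_ne_zero.2 fun e => h1T (e ▸ hlamT i)
    by_contra hno
    push Not at hno
    apply h1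
    rw [← Finset.add_sum_erase J _ hj₁] at hE
    have hrest : ∑ j ∈ J.erase j₁, a j * ∏ i, (w j i - lam i) = 0 := by
      refine Finset.sum_eq_zero fun j hj => ?_
      have hj' := hno j hj
      rw [Fintype.mem_piFinset] at hj'
      push Not at hj'
      obtain ⟨i, hi⟩ := hj'
      have heq : lam i = w j i := by
        by_contra hne
        exact hi (Finset.mem_erase.2 ⟨hne, hlamT i⟩)
      exact mul_eq_zero_of_right _
        (Finset.prod_eq_zero (Finset.mem_univ i) (by rw [heq, sub_self]))
    rwa [hrest, add_zero] at hE
  calc T.card ^ n = Λ.card := hΛcard.symm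
    _ ≤ ((J.erase j₁).biUnion fun j => Fintype.piFinset fun i => T.erase (w j i)).card :=
        Finset.card_le_card fun lam hlam => Finset.mem_biUnion.2 (hcover lam hlam)
    _ ≤ ∑ j ∈ J.erase j₁, (Fintype.piFinset fun i => T.erase (w j i)).card :=
        Finset.card_biUnion_le
    _ = ∑ j ∈ J.erase j₁, ∏ i, (T.erase (w j i)).card :=
        Finset.sum_congr rfl fun j _ => by rw [Fintype.card_piFinset]

/-- **Isolation lemma**, two marked values (`T = {ω, ω²}` in `𝔽₄`): if every member other than `𝟙`
has at least `d` marked entries then the relation has at least `2^d + 1` members.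
[cite: BarringtonStraubingTherien1990, §6 Thm. 7 and Proposition (pp. 123–125) — isolation form supplied here; cf. AlonFuredi1993, Thm. 1] -/
theorem two_pow_add_one_le_card {n : ℕ} {ι : Type*} [DecidableEq ι] (T : Finset F)
    (h1T : (1 : F) ∉ T) (hT : T.card = 2) (J : Finset ι) (a : ι → F) (w : ι → Fin n → F)
    (j₁ : ι) (hj₁ : j₁ ∈ J) (hw₁ : ∀ i, w j₁ i = 1) (ha₁ : a j₁ ≠ 0)
    (hrel : ∀ u, ∑ j ∈ J, a j * prodFn (w j) u = 0) (d : ℕ)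
    (hd : ∀ j ∈ J, j ≠ j₁ → d ≤ (univ.filter fun i => w j i ∈ T).card) :
    2 ^ d + 1 ≤ J.card := by
  have hiso := card_pow_le_sum_prod_card_erase T h1T J a w j₁ hj₁ hw₁ ha₁ hrel
  rw [hT] at hiso
  have hper : ∀ j ∈ J.erase j₁, (∏ i, (T.erase (w j i)).card) * 2 ^ d ≤ 2 ^ n := by
    intro j hj
    have hjJ := Finset.mem_erase.1 hj
    have hcard_i : ∀ i, (T.erase (w j i)).card = if w j i ∈ T then 1 else 2 := by
      intro i
      split_ifs with h
      · rw [Finset.card_erase_of_mem h, hT]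
      · rw [Finset.erase_eq_of_notMem h, hT]
    simp_rw [hcard_i]
    rw [Finset.prod_ite, Finset.prod_const_one, one_mul, Finset.prod_const]
    have hsum := Finset.card_filter_add_card_filter_not
      (s := (univ : Finset (Fin n))) (fun i => w j i ∈ T)
    rw [Finset.card_univ, Fintype.card_fin] at hsum
    calc 2 ^ (univ.filter fun i => ¬ (w j i ∈ T)).card * 2 ^ d
        ≤ 2 ^ (univ.filter fun i => ¬ (w j i ∈ T)).card *
            2 ^ (univ.filter fun i => w j i ∈ T).card :=
          Nat.mul_le_mul_left _ (Nat.pow_le_pow_right (by norm_num) (hd j hjJ.2 hjJ.1))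
      _ = 2 ^ n := by rw [← pow_add, add_comm, hsum]
  have key : 2 ^ d * 2 ^ n ≤ (J.erase j₁).card * 2 ^ n := by
    calc 2 ^ d * 2 ^ n = 2 ^ n * 2 ^ d := mul_comm _ _
      _ ≤ (∑ j ∈ J.erase j₁, ∏ i, (T.erase (w j i)).card) * 2 ^ d :=
          Nat.mul_le_mul_right _ hiso
      _ = ∑ j ∈ J.erase j₁, (∏ i, (T.erase (w j i)).card) * 2 ^ d := Finset.sum_mul _ _ _
      _ ≤ ∑ j ∈ J.erase j₁, 2 ^ n := Finset.sum_le_sum hper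
      _ = (J.erase j₁).card * 2 ^ n := by rw [Finset.sum_const, smul_eq_mul]
  have h2 : 2 ^ d ≤ (J.erase j₁).card := Nat.le_of_mul_le_mul_right key (by positivity)
  have h3 := Finset.card_erase_add_one hj₁
  omega


/-! ## Isolation on a parity class (characteristic 2)

A relation `Σ_j a_j Q_{w_j} ≡ 0` holding only on a parity class `H_p = {u : #ones(u) ≡ p (2)}` of the cube, entries in `{1, ω, ω²}`
(`ω² + ω + 1 = 0`, `char F = 2`): if the NET coefficient of the pattern `w_{j₁}` (the sum of `a_j` over the `j` with `w_j = w_{j₁}`) is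
non-zero and every other pattern differs from `w_{j₁}` in at least `d` coordinates, then `2^{n-1} ≤ 3·n·#{j : w_j ≠ w_{j₁}}·2^{n-d}`, i.e.
`2^{d-1} ≤ 3 n · #{other patterns}`.  Tool: `1_{H_p}·Q_w = (1+p+n) Q_w − Σ_i Q_{w[i↦0]}` (char 2), so `E_λ(1_{H_p} Q_w)` vanishes as soon as
`λ` agrees with `w` in two coordinates, while for `λ_{i₀} = 1`, `λ_k ∈ {ω, ω²}` (`k ≠ i₀`) one has `E_λ(1_{H_p}) = ∏_{k ≠ i₀} (1 − λ_k) ≠ 0`. -/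

section ParityIsolation

/-- The number of ones of `u ∈ {0,1}ⁿ` (Hamming weight). [folklore] -/
def bitCount {n : ℕ} (u : Fin n → Bool) : ℕ := (univ.filter fun i => u i = true).card

/-- `#ones(u) ≤ n`. [cite: BarringtonStraubingTherien1990, §6 (setting: functions on the cube and product functions, p. 124); elementary] -/
theorem bitCount_le {n : ℕ} (u : Fin n → Bool) : bitCount u ≤ n :=
  (card_filter_le _ _).trans (by rw [card_univ, Fintype.card_fin])

/-- `#ones(u) + #zeros(u) = n`. [cite: BarringtonStraubingTherien1990, §6 (setting: functions on the cube and product functions, p. 124); elementary] -/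
theorem bitCount_add_card_false {n : ℕ} (u : Fin n → Bool) :
    bitCount u + (univ.filter fun i => ¬ (u i = true)).card = n := by
  unfold bitCount
  have h := Finset.card_filter_add_card_filter_not (s := (univ : Finset (Fin n))) (fun i => u i = true)
  rw [card_univ, Fintype.card_fin] at h
  exact h

/-- `1_{H_p} · Q_w`: the product function `Q_w` cut off to the parity class
`H_p = {u : #ones(u) ≡ p (mod 2)}`. [folklore] -/
def hpProd {n : ℕ} (p : ℕ) (w : Fin n → F) (u : Fin n → Bool) : F :=
  if bitCount u % 2 = p % 2 then prodFn w u else 0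

omit [DecidableEq F] in
/-- In characteristic `2`, `(m : F) = [m odd]`. [folklore] -/
private theorem natCast_eq_ite' [CharP F 2] (m : ℕ) : (m : F) = if m % 2 = 1 then 1 else 0 := by
  have h2 : (2 : F) = 0 := CharTwo.two_eq_zero
  conv_lhs => rw [← Nat.div_add_mod m 2]
  push_cast
  rw [h2]
  split_ifs with h
  · rw [h]; simp
  · have h' : m % 2 = 0 := by omega
    rw [h']; simp

omit [DecidableEq F] in
/-- Zeroing one entry: `Q_{w[i↦0]}(u) = [u_i = 0]·Q_w(u)`. [cite: BarringtonStraubingTherien1990, §6 (setting: functions on the cube and product functions, p. 124); elementary] -/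
theorem prodFn_update_zero {n : ℕ} (w : Fin n → F) (i : Fin n) (u : Fin n → Bool) :
    prodFn (Function.update w i 0) u = if u i then 0 else prodFn w u := by
  unfold prodFn
  rw [← Finset.mul_prod_erase univ _ (mem_univ i),
    ← Finset.mul_prod_erase univ (fun k => if u k then w k else 1) (mem_univ i)]
  have hrest : ∏ k ∈ univ.erase i, (if u k then Function.update w i 0 k else 1) =
      ∏ k ∈ univ.erase i, (if u k then w k else 1) :=
    prod_congr rfl fun k hk => by rw [Function.update_of_ne (ne_of_mem_erase hk)]
  rw [hrest, Function.update_self]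
  cases u i <;> simp

omit [DecidableEq F] in
/-- `1_{H_p}·Q_w = (1+p+n)·Q_w + Σ_i (−1)·Q_{w[i↦0]}` (char 2). [cite: BarringtonStraubingTherien1990, §6 (product functions, p. 124) — parity-class identity supplied here; elementary] -/
theorem hpProd_eq [CharP F 2] {n : ℕ} (p : ℕ) (w : Fin n → F) (u : Fin n → Bool) :
    hpProd p w u = ((1 + p + n : ℕ) : F) * prodFn w u + ∑ i, (-1 : F) * prodFn (Function.update w i 0) u := by
  have hsum : ∑ i, (-1 : F) * prodFn (Function.update w i 0) u = -(((n - bitCount u : ℕ) : F) * prodFn w u) := by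
    simp_rw [prodFn_update_zero]
    rw [← Finset.mul_sum, Finset.sum_ite, sum_const_zero, zero_add, sum_const, nsmul_eq_mul, neg_one_mul]
    congr 2
    have h := bitCount_add_card_false u
    have h' : (univ.filter fun i => ¬ (u i = true)).card = n - bitCount u := by omega
    rw [h']
  rw [hsum]
  have hle := bitCount_le u
  have hcast : ((1 + p + n : ℕ) : F) * prodFn w u + -(((n - bitCount u : ℕ) : F) * prodFn w u) =
      ((1 + p + bitCount u : ℕ) : F) * prodFn w u := by
    push_cast [Nat.cast_sub hle]
    ring
  rw [hcast, natCast_eq_ite']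
  unfold hpProd
  by_cases h : bitCount u % 2 = p % 2
  · rw [if_pos h, if_pos (by omega), one_mul]
  · rw [if_neg h, if_neg (by omega), zero_mul]

omit [DecidableEq F] in
/-- `E_λ(1_{H_p} Q_w) = (1+p+n) ∏_k (w_k − λ_k) + Σ_i (−1) ∏_k (w[i↦0]_k − λ_k)`.
[cite: BarringtonStraubingTherien1990, §6 (product functions, p. 124) — parity-class identity supplied here; elementary] -/
theorem evalFn_hpProd [CharP F 2] {n : ℕ} (p : ℕ) (lam w : Fin n → F) :
    evalFn n lam (hpProd p w) = ((1 + p + n : ℕ) : F) * ∏ k, (w k - lam k) +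
      ∑ i, (-1 : F) * ∏ k, (Function.update w i 0 k - lam k) := by
  let a : Option (Fin n) → F := fun o => o.elim ((1 + p + n : ℕ) : F) (fun _ => -1)
  let f : Option (Fin n) → (Fin n → Bool) → F := fun o => o.elim (prodFn w) (fun i => prodFn (Function.update w i 0))
  have h := evalFn_sum (univ : Finset (Option (Fin n))) a n lam f (hpProd p w) (fun u => by
    rw [hpProd_eq, Fintype.sum_option]; rfl)
  rw [h, Fintype.sum_option]
  simp only [a, f, Option.elim, evalFn_prodFn]

omit [DecidableEq F] in
/-- (P1) Two coincidences kill `E_λ(1_{H_p} Q_w)`. [cite: BarringtonStraubingTherien1990, §6 (product functions, p. 124) — parity-class identity supplied here; elementary] -/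
theorem evalFn_hpProd_eq_zero [CharP F 2] {n : ℕ} (p : ℕ) (lam w : Fin n → F) {i i' : Fin n} (hii : i ≠ i')
    (hi : lam i = w i) (hi' : lam i' = w i') : evalFn n lam (hpProd p w) = 0 := by
  rw [evalFn_hpProd]
  have hP : ∏ k, (w k - lam k) = 0 := prod_eq_zero (mem_univ i) (by rw [hi, sub_self])
  have hPi : ∀ i'', ∏ k, (Function.update w i'' 0 k - lam k) = 0 := by
    intro i''
    by_cases h : i'' = i
    · refine prod_eq_zero (mem_univ i') ?_
      rw [Function.update_of_ne (show i' ≠ i'' by rw [h]; exact hii.symm), hi', sub_self]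
    · refine prod_eq_zero (mem_univ i) ?_
      rw [Function.update_of_ne (show i ≠ i'' from fun e => h e.symm), hi, sub_self]
  simp [hP, hPi]

omit [DecidableEq F] in
/-- (P2) At `λ_{i₀} = 1`, `λ_k ∈ T ∌ 1` (`k ≠ i₀`): `E_λ(1_{H_p}) = ∏_{k≠i₀} (1 − λ_k) ≠ 0`.
[cite: BarringtonStraubingTherien1990, §6 (product functions, p. 124) — parity-class identity supplied here; elementary] -/
theorem evalFn_hpProd_one_ne_zero [CharP F 2] {n : ℕ} (p : ℕ) (T : Finset F) (h1T : (1 : F) ∉ T) (i₀ : Fin n)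
    (lam : Fin n → F) (h0 : lam i₀ = 1) (hT : ∀ k, k ≠ i₀ → lam k ∈ T) :
    evalFn n lam (hpProd p (fun _ => (1 : F))) ≠ 0 := by
  rw [evalFn_hpProd]
  have hP : ∏ k, ((fun _ => (1 : F)) k - lam k) = 0 := prod_eq_zero (mem_univ i₀) (by simp [h0])
  have hPi : ∀ i, i ≠ i₀ → ∏ k, (Function.update (fun _ => (1 : F)) i 0 k - lam k) = 0 := fun i hi =>
    prod_eq_zero (mem_univ i₀) (by rw [Function.update_of_ne (Ne.symm hi)]; simp [h0])
  have hPi₀ : ∏ k, (Function.update (fun _ => (1 : F)) i₀ 0 k - lam k) = -∏ k ∈ univ.erase i₀, (1 - lam k) := by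
    rw [← Finset.mul_prod_erase univ _ (mem_univ i₀), Function.update_self, h0, zero_sub, neg_one_mul]
    congr 1
    exact prod_congr rfl fun k hk => by rw [Function.update_of_ne (ne_of_mem_erase hk)]
  rw [hP, mul_zero, zero_add,
    Finset.sum_eq_single i₀ (fun i _ hi => by rw [hPi i hi, mul_zero]) (fun h => absurd (mem_univ i₀) h), hPi₀,
    neg_one_mul, neg_neg]
  exact prod_ne_zero_iff.2 fun k hk => sub_ne_zero.2 fun e => h1T (e ▸ hT k (ne_of_mem_erase hk))

/-- **PARITY-CLASS ISOLATION (core, `w_{j₁} = 𝟙`).**  `T` any 2-set not containing `1`; "distance" of `w_j` to `𝟙` is measured as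
`#{i : w_j i ∈ T}` (no hypothesis on the other entries is needed).
[cite: BarringtonStraubingTherien1990, §6 Thm. 7 and Proposition (pp. 123–125) — parity-class isolation form supplied here; cf. AlonFuredi1993, Thm. 1] -/
theorem parity_isolation_core [CharP F 2] {n : ℕ} (i₀ : Fin n) {ι : Type*} [DecidableEq ι]
    (T : Finset F) (h1T : (1 : F) ∉ T) (hT2 : T.card = 2)
    (J : Finset ι) (a : ι → F) (w : ι → Fin n → F)
    (j₁ : ι) (hw₁ : ∀ i, w j₁ i = 1)
    (hnet : ∑ j ∈ J.filter (fun j => w j = w j₁), a j ≠ 0) (p : ℕ)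
    (hrel : ∀ u : Fin n → Bool, bitCount u % 2 = p % 2 → ∑ j ∈ J, a j * prodFn (w j) u = 0)
    (d : ℕ) (hd : ∀ j ∈ J, w j ≠ w j₁ → d ≤ (univ.filter fun i => w j i ∈ T).card) :
    2 ^ (n - 1) ≤ 3 * n * (J.filter fun j => w j ≠ w j₁).card * 2 ^ (n - d) := by
  have hw₁' : w j₁ = fun _ => 1 := funext hw₁
  -- the test set Λ = {λ : λ_{i₀} = 1, λ_k ∈ T otherwise}
  set Λ : Finset (Fin n → F) := Fintype.piFinset (fun i => if i = i₀ then ({1} : Finset F) else T) with hΛ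
  have hΛcard : Λ.card = 2 ^ (n - 1) := by
    have hfac : ∀ k : Fin n, (if k = i₀ then ({1} : Finset F) else T).card = if k = i₀ then 1 else 2 := by
      intro k; split_ifs <;> simp [hT2]
    rw [hΛ, Fintype.card_piFinset]
    simp_rw [hfac]
    rw [← Finset.mul_prod_erase univ _ (mem_univ i₀), if_pos rfl, one_mul,
      prod_congr rfl fun k hk => if_neg (ne_of_mem_erase hk), prod_const, card_erase_of_mem (mem_univ i₀),
      card_univ, Fintype.card_fin]
  -- the relation times 1_{H_p} holds on the whole cube
  have hrel' : ∀ u, (0 : F) = ∑ j ∈ J, a j * hpProd p (w j) u := by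
    intro u
    unfold hpProd
    by_cases h : bitCount u % 2 = p % 2
    · simp only [if_pos h]; exact (hrel u h).symm
    · simp only [if_neg h, mul_zero, sum_const_zero]
  -- boxes
  set NT := J.filter fun j => w j ≠ w j₁ with hNT
  set box : ι → Fin n → Fin n → Finset F :=
    fun j i₁ i => if i = i₁ then insert 1 T else (if i = i₀ then ({1} : Finset F) else T).erase (w j i) with hbox
  -- COVER: every λ ∈ Λ lies in some box (j, i₁), j a non-twin
  have hcover : ∀ lam ∈ Λ, ∃ ji ∈ NT ×ˢ (univ : Finset (Fin n)), lam ∈ Fintype.piFinset (box ji.1 ji.2) := by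
    intro lam hlam
    have hlamL : ∀ i, lam i ∈ (if i = i₀ then ({1} : Finset F) else T) := Fintype.mem_piFinset.1 hlam
    have hlam0 : lam i₀ = 1 := by have := hlamL i₀; simpa using this
    have hlamT : ∀ k, k ≠ i₀ → lam k ∈ T := fun k hk => by have := hlamL k; simpa [hk] using this
    have hE : ∑ j ∈ J, a j * evalFn n lam (hpProd p (w j)) = 0 := by
      have h := evalFn_sum J a n lam (fun j => hpProd p (w j)) (fun _ => 0) hrel'
      rw [evalFn_zero] at h
      exact h.symm
    rw [← Finset.sum_filter_add_sum_filter_not J (fun j => w j = w j₁)] at hE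
    have htw : ∑ j ∈ J.filter (fun j => w j = w j₁), a j * evalFn n lam (hpProd p (w j)) =
        (∑ j ∈ J.filter (fun j => w j = w j₁), a j) * evalFn n lam (hpProd p (fun _ => (1 : F))) := by
      rw [Finset.sum_mul]
      refine sum_congr rfl fun j hj => ?_
      rw [(mem_filter.1 hj).2, hw₁']
    rw [htw] at hE
    have hne : ∑ j ∈ NT, a j * evalFn n lam (hpProd p (w j)) ≠ 0 := by
      intro h0
      rw [hNT] at h0
      rw [h0, add_zero] at hE
      exact mul_ne_zero hnet (evalFn_hpProd_one_ne_zero p T h1T i₀ lam hlam0 hlamT) hE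
    obtain ⟨j, hj, hj0⟩ := Finset.exists_ne_zero_of_sum_ne_zero hne
    have hE0 : evalFn n lam (hpProd p (w j)) ≠ 0 := fun h => hj0 (by rw [h, mul_zero])
    -- at most one coincidence
    have hone : ∃ i₁ : Fin n, ∀ i, i ≠ i₁ → lam i ≠ w j i := by
      by_cases h : ∃ i, lam i = w j i
      · obtain ⟨i₁, hi₁⟩ := h
        refine ⟨i₁, fun i hi e => hE0 (evalFn_hpProd_eq_zero p lam (w j) hi e hi₁)⟩
      · push Not at h
        exact ⟨i₀, fun i _ => h i⟩
    obtain ⟨i₁, hi₁⟩ := hone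
    refine ⟨(j, i₁), Finset.mem_product.2 ⟨hj, mem_univ _⟩, Fintype.mem_piFinset.2 fun i => ?_⟩
    show lam i ∈ (if i = i₁ then insert 1 T else (if i = i₀ then ({1} : Finset F) else T).erase (w j i))
    by_cases h : i = i₁
    · simp only [h, if_true]
      by_cases h0 : i₁ = i₀
      · rw [h0, hlam0]; exact mem_insert_self _ _
      · exact mem_insert_of_mem (hlamT i₁ h0)
    · simp only [if_neg h]
      exact mem_erase.2 ⟨hi₁ i h, hlamL i⟩
  -- SIZE of a box
  have hboxcard : ∀ j ∈ NT, ∀ i₁ : Fin n, (Fintype.piFinset (box j i₁)).card ≤ 3 * 2 ^ (n - d) := by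
    intro j hj i₁
    have hjJ : j ∈ J := (mem_filter.1 hj).1
    have hjne : w j ≠ w j₁ := (mem_filter.1 hj).2
    rw [Fintype.card_piFinset]
    have hterm : ∀ i, (box j i₁ i).card ≤ (if i = i₁ then 3 else 1) * (if w j i ∈ T then 1 else 2) := by
      intro i
      show (if i = i₁ then insert 1 T else (if i = i₀ then ({1} : Finset F) else T).erase (w j i)).card ≤ _
      by_cases h : i = i₁
      · simp only [h, if_true]
        rw [card_insert_of_notMem h1T, hT2]
        split_ifs <;> norm_num
      · simp only [if_neg h, one_mul]
        by_cases h0 : i = i₀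
        · simp only [h0, if_true]
          calc (({1} : Finset F).erase (w j i₀)).card ≤ ({1} : Finset F).card := card_erase_le
            _ = 1 := card_singleton _
            _ ≤ _ := by split_ifs <;> norm_num
        · simp only [if_neg h0]
          split_ifs with hw
          · rw [card_erase_of_mem hw, hT2]
          · rw [erase_eq_of_notMem hw, hT2]
    have hprod : ∏ i, (box j i₁ i).card ≤ ∏ i, ((if i = i₁ then 3 else 1) * (if w j i ∈ T then 1 else 2)) :=
      prod_le_prod (fun i _ => Nat.zero_le _) (fun i _ => hterm i)
    refine hprod.trans ?_
    rw [prod_mul_distrib, Finset.prod_ite_eq' univ i₁ (fun _ => 3), if_pos (mem_univ _),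
      Finset.prod_ite, prod_const_one, one_mul, prod_const]
    refine Nat.mul_le_mul_left _ (Nat.pow_le_pow_right (by norm_num) ?_)
    have hsum := Finset.card_filter_add_card_filter_not (s := (univ : Finset (Fin n))) (fun i => w j i ∈ T)
    rw [card_univ, Fintype.card_fin] at hsum
    have := hd j hjJ hjne
    omega
  -- ASSEMBLE
  calc 2 ^ (n - 1) = Λ.card := hΛcard.symm
    _ ≤ ((NT ×ˢ (univ : Finset (Fin n))).biUnion fun ji => Fintype.piFinset (box ji.1 ji.2)).card :=
        card_le_card fun lam hlam => mem_biUnion.2 (hcover lam hlam)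
    _ ≤ ∑ ji ∈ NT ×ˢ (univ : Finset (Fin n)), (Fintype.piFinset (box ji.1 ji.2)).card := card_biUnion_le
    _ ≤ ∑ ji ∈ NT ×ˢ (univ : Finset (Fin n)), 3 * 2 ^ (n - d) :=
        sum_le_sum fun ji hji => hboxcard ji.1 (Finset.mem_product.1 hji).1 ji.2
    _ = 3 * n * NT.card * 2 ^ (n - d) := by
        rw [sum_const, smul_eq_mul, card_product, card_univ, Fintype.card_fin]; ring

/-! ### The user-facing form: entries in `{1, ω, ω²}`, Hamming distance to `w_{j₁}` -/

omit [DecidableEq F] in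
/-- `ω³ = 1` for a root of `X² + X + 1` in characteristic `2`. [folklore] -/
private theorem omega_pow_three' [CharP F 2] {ω : F} (hω : ω ^ 2 + ω + 1 = 0) : ω ^ 3 = 1 := by
  have h2 : (2 : F) = 0 := CharTwo.two_eq_zero
  linear_combination (ω + 1) * hω - (ω ^ 2 + ω + 1) * h2

omit [DecidableEq F] in
/-- `ω ≠ 0`. [folklore] -/
private theorem omega_ne_zero'' {ω : F} (hω : ω ^ 2 + ω + 1 = 0) : ω ≠ 0 := by
  intro h; rw [h] at hω; simp at hω

omit [DecidableEq F] in
/-- `ω ≠ 1` (characteristic `2`). [folklore] -/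
private theorem omega_ne_one'' [CharP F 2] {ω : F} (hω : ω ^ 2 + ω + 1 = 0) : ω ≠ 1 := by
  intro h; subst h
  have h2 : (2 : F) = 0 := CharTwo.two_eq_zero
  exact one_ne_zero (by linear_combination hω - h2 : (1 : F) = 0)

omit [DecidableEq F] in
/-- `ω² ≠ 1` (characteristic `2`). [folklore] -/
private theorem omega_sq_ne_one [CharP F 2] {ω : F} (hω : ω ^ 2 + ω + 1 = 0) : ω ^ 2 ≠ 1 := by
  intro h
  have h2 : (2 : F) = 0 := CharTwo.two_eq_zero
  have : ω = 0 := by linear_combination hω - h - h2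
  exact omega_ne_zero'' hω this

omit [DecidableEq F] in
/-- `ω² ≠ ω` (characteristic `2`). [folklore] -/
private theorem omega_sq_ne_omega [CharP F 2] {ω : F} (hω : ω ^ 2 + ω + 1 = 0) : ω ^ 2 ≠ ω := by
  intro h
  have h2 : (2 : F) = 0 := CharTwo.two_eq_zero
  have : (1 : F) = 0 := by linear_combination hω - h - ω * h2
  exact one_ne_zero this

omit [DecidableEq F] in
/-- `ω^m = ω^{m mod 3}` when `ω³ = 1`. [folklore] -/
private theorem pow_eq_pow_mod_three' {ω : F} (h3 : ω ^ 3 = 1) (m : ℕ) : ω ^ m = ω ^ (m % 3) := by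
  conv_lhs => rw [← Nat.div_add_mod m 3, pow_add, pow_mul, h3, one_pow, one_mul]

/-- Membership in `{1, ω, ω²}` as a power of `ω`. [folklore] -/
private theorem mem_cubeRoots_iff {ω : F} (x : F) : x ∈ ({1, ω, ω ^ 2} : Finset F) ↔ ∃ m : ℕ, m < 3 ∧ x = ω ^ m := by
  simp only [mem_insert, mem_singleton]
  constructor
  · rintro (rfl | rfl | rfl)
    · exact ⟨0, by norm_num, by simp⟩
    · exact ⟨1, by norm_num, by simp⟩
    · exact ⟨2, by norm_num, rfl⟩
  · rintro ⟨m, hm, rfl⟩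
    interval_cases m <;> simp

/-- Powers of `ω` lie in `{1, ω, ω²}` (`ω³ = 1`). [folklore] -/
private theorem pow_mem_cubeRoots' {ω : F} (h3 : ω ^ 3 = 1) (m : ℕ) : ω ^ m ∈ ({1, ω, ω ^ 2} : Finset F) := by
  exact (mem_cubeRoots_iff _).2 ⟨m % 3, Nat.mod_lt _ (by norm_num), pow_eq_pow_mod_three' h3 m⟩

/-- Quotients of cube roots of unity are cube roots of unity. [folklore] -/
private theorem div_mem_cubeRoots [CharP F 2] {ω : F} (hω : ω ^ 2 + ω + 1 = 0) {x y : F}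
    (hx : x ∈ ({1, ω, ω ^ 2} : Finset F)) (hy : y ∈ ({1, ω, ω ^ 2} : Finset F)) :
    x / y ∈ ({1, ω, ω ^ 2} : Finset F) := by
  have h3 := omega_pow_three' hω
  obtain ⟨mx, -, rfl⟩ := (mem_cubeRoots_iff x).1 hx
  obtain ⟨my, -, rfl⟩ := (mem_cubeRoots_iff y).1 hy
  have hinv : (ω ^ my)⁻¹ = ω ^ (2 * my) :=
    inv_eq_of_mul_eq_one_right (by rw [← pow_add, show my + 2 * my = 3 * my by ring, pow_mul, h3, one_pow])
  rw [div_eq_mul_inv, hinv, ← pow_add]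
  exact pow_mem_cubeRoots' h3 _

/-- **PARITY-CLASS ISOLATION LEMMA.**  `F` of characteristic 2 with `ω² + ω + 1 = 0`; a relation `Σ_j a_j Q_{w_j} ≡ 0` on the parity
class `H_p ⊆ {0,1}^n` (`n ≥ 1`), all entries in `{1, ω, ω²}`; if the net coefficient of the pattern `w_{j₁}` is non-zero and every other
pattern is at Hamming distance `≥ d` from `w_{j₁}`, then `2^{n−1} ≤ 3·n·#{j : w_j ≠ w_{j₁}}·2^{n−d}`.
[cite: BarringtonStraubingTherien1990, §6 Thm. 7 and Proposition (pp. 123–125) — parity-class isolation form supplied here] -/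
theorem parity_isolation [CharP F 2] {ω : F} (hω : ω ^ 2 + ω + 1 = 0) {n : ℕ} (hn : 1 ≤ n) {ι : Type*} [DecidableEq ι]
    (J : Finset ι) (a : ι → F) (w : ι → Fin n → F) (hw : ∀ j ∈ J, ∀ i, w j i ∈ ({1, ω, ω ^ 2} : Finset F))
    (j₁ : ι) (hj₁ : j₁ ∈ J) (hnet : ∑ j ∈ J.filter (fun j => w j = w j₁), a j ≠ 0) (p : ℕ)
    (hrel : ∀ u : Fin n → Bool, bitCount u % 2 = p % 2 → ∑ j ∈ J, a j * prodFn (w j) u = 0)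
    (d : ℕ) (hd : ∀ j ∈ J, w j ≠ w j₁ → d ≤ (univ.filter fun i => w j i ≠ w j₁ i).card) :
    2 ^ (n - 1) ≤ 3 * n * (J.filter fun j => w j ≠ w j₁).card * 2 ^ (n - d) := by
  have h3 := omega_pow_three' hω
  have hw₁ne : ∀ i, w j₁ i ≠ 0 := by
    intro i h0
    obtain ⟨m, -, hm⟩ := (mem_cubeRoots_iff _).1 (hw j₁ hj₁ i)
    exact pow_ne_zero m (omega_ne_zero'' hω) (hm ▸ h0)
  -- rescale
  set w' : ι → Fin n → F := fun j i => w j i / w j₁ i with hw'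
  set T : Finset F := {ω, ω ^ 2} with hT
  have h1T : (1 : F) ∉ T := by
    rw [hT]; simp only [mem_insert, mem_singleton, not_or]
    exact ⟨fun h => omega_ne_one'' hω h.symm, fun h => omega_sq_ne_one hω h.symm⟩
  have hT2 : T.card = 2 := by
    rw [hT, card_insert_of_notMem (by simpa using (omega_sq_ne_omega hω).symm), card_singleton]
  have hwV : ∀ j ∈ J, ∀ i, w' j i = 1 ∨ w' j i ∈ T := by
    intro j hj i
    have hmem : w' j i ∈ ({1, ω, ω ^ 2} : Finset F) := div_mem_cubeRoots hω (hw j hj i) (hw j₁ hj₁ i)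
    simp only [mem_insert, mem_singleton] at hmem
    rcases hmem with h | h | h
    · exact Or.inl h
    · exact Or.inr (by rw [hT, h]; simp)
    · exact Or.inr (by rw [hT, h]; simp)
  have hw₁ : ∀ i, w' j₁ i = 1 := fun i => div_self (hw₁ne i)
  have htwin : ∀ j, w' j = w' j₁ ↔ w j = w j₁ := by
    intro j
    constructor
    · intro h; funext i
      have hi : w j i / w j₁ i = w j₁ i / w j₁ i := congrFun h i
      rw [div_self (hw₁ne i), div_eq_one_iff_eq (hw₁ne i)] at hi
      exact hi
    · intro h
      show (fun i => w j i / w j₁ i) = fun i => w j₁ i / w j₁ i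
      rw [h]
  have hfilt_eq : (J.filter fun j => w' j = w' j₁) = J.filter fun j => w j = w j₁ :=
    filter_congr fun j _ => htwin j
  have hfilt_ne : (J.filter fun j => w' j ≠ w' j₁) = J.filter fun j => w j ≠ w j₁ :=
    filter_congr fun j _ => (htwin j).not
  have hnet' : ∑ j ∈ J.filter (fun j => w' j = w' j₁), a j ≠ 0 := by rwa [hfilt_eq]
  have hrel' : ∀ u : Fin n → Bool, bitCount u % 2 = p % 2 → ∑ j ∈ J, a j * prodFn (w' j) u = 0 := by
    intro u hu
    have hprod : ∀ j, prodFn (w' j) u = prodFn (w j) u * prodFn (fun i => (w j₁ i)⁻¹) u := by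
      intro j; rw [prodFn_mul]
      show prodFn (fun i => w j i / w j₁ i) u = _
      simp only [div_eq_mul_inv]
    simp_rw [hprod, ← mul_assoc, ← Finset.sum_mul, hrel u hu, zero_mul]
  have hd' : ∀ j ∈ J, w' j ≠ w' j₁ → d ≤ (univ.filter fun i => w' j i ∈ T).card := by
    intro j hj hne
    refine (hd j hj ((htwin j).not.1 hne)).trans (card_le_card fun i hi => ?_)
    have hine : w j i ≠ w j₁ i := (mem_filter.1 hi).2
    refine mem_filter.2 ⟨mem_univ _, ?_⟩
    rcases hwV j hj i with h | h
    · exfalso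
      have h' : w j i / w j₁ i = 1 := h
      rw [div_eq_one_iff_eq (hw₁ne i)] at h'
      exact hine h'
    · exact h
  have key := parity_isolation_core ⟨0, hn⟩ T h1T hT2 J a w' j₁ hw₁ hnet' p hrel' d hd'
  rwa [hfilt_ne] at key

/-- Cleaned-up consequence: with `d ≤ n`, `2^{d−1} ≤ 3·n·#{j : w_j ≠ w_{j₁}}`; in particular a pattern with non-zero net coefficient has
another pattern of the relation within Hamming distance `log₂(6 n · #J)`.
[cite: BarringtonStraubingTherien1990, §6 Thm. 7 and Proposition (pp. 123–125) — parity-class isolation form supplied here] -/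
theorem parity_isolation_dist [CharP F 2] {ω : F} (hω : ω ^ 2 + ω + 1 = 0) {n : ℕ} (hn : 1 ≤ n) {ι : Type*} [DecidableEq ι]
    (J : Finset ι) (a : ι → F) (w : ι → Fin n → F) (hw : ∀ j ∈ J, ∀ i, w j i ∈ ({1, ω, ω ^ 2} : Finset F))
    (j₁ : ι) (hj₁ : j₁ ∈ J) (hnet : ∑ j ∈ J.filter (fun j => w j = w j₁), a j ≠ 0) (p : ℕ)
    (hrel : ∀ u : Fin n → Bool, bitCount u % 2 = p % 2 → ∑ j ∈ J, a j * prodFn (w j) u = 0)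
    (d : ℕ) (hdn : d ≤ n) (hd : ∀ j ∈ J, w j ≠ w j₁ → d ≤ (univ.filter fun i => w j i ≠ w j₁ i).card) :
    2 ^ (d - 1) ≤ 3 * n * (J.filter fun j => w j ≠ w j₁).card := by
  have key := parity_isolation hω hn J a w hw j₁ hj₁ hnet p hrel d hd
  rcases Nat.eq_zero_or_pos d with rfl | hdpos
  · simp only [Nat.zero_sub, pow_zero]
    -- 1 ≤ 3 n #NT : from key with d = 0: 2^(n-1) ≤ 3 n #NT 2^n; need #NT ≥ 1
    by_contra h0
    push Not at h0
    have : 3 * n * (J.filter fun j => w j ≠ w j₁).card = 0 := by omega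
    rw [this, zero_mul] at key
    exact absurd key (not_le.2 (by positivity))
  · have h2 : 2 ^ (n - 1) = 2 ^ (d - 1) * 2 ^ (n - d) := by rw [← pow_add]; congr 1; omega
    rw [h2] at key
    exact Nat.le_of_mul_le_mul_right key (by positivity)

end ParityIsolation

end Isolation

end ProductSpan

end Literature.Computability.MetaComplexity
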